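import Mathlib
import HarnessLib
import Literature.MathematicalPhysics.StatisticalMechanics.RenormalisationStepLocality
import Literature.MathematicalPhysics.StatisticalMechanics.RenormalisationStepTranslation
import Literature.MathematicalPhysics.StatisticalMechanics.ReblockingNeighbourhoods
import Literature.MathematicalPhysics.StatisticalMechanics.FiniteRangeFactorisation
import Literature.MathematicalPhysics.StatisticalMechanics.RelevantProjection
import Literature.MathematicalPhysics.StatisticalMechanics.RenormalisationStepFactorisation

/-!
# The renormalisation transformation `T_k : (H_k, K_k) ↦ (H_{k+1}, K_{k+1})` of a complex gradient
# perturbation ([ABKM19] Definition 6.5) — the concrete map, its representation identity,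
# translation invariance and locality

This file fixes the renormalisation map of Adams–Buchholz–Kotecký–Müller for ONE step
`k → k+1` on the torus `(ℤ/M)^d`, complex-valued (`𝕜 = ℂ`, the `ι`-symmetric class of the
complex gradient perturbation is a real-linear subspace treated elsewhere):

* the data of a step, `StepData`: block side `s = L^k`, ratio `L`, the kernel `𝒞 = 𝒞_{k+1}` of the
  fluctuation measure `μ_{k+1} = N(0, circulant 𝒞)` (`stepMeasure`), and the reference block `B₀`
  with the corner `c₀` of its test-polynomial box (for `Π₂`);
* `fluct 𝒞 F = R_{k+1}F = ∫ F(· + ξ) μ_{k+1}(dξ)`;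
* **`nextH D H K = Π₂ R_{k+1} H(B₀) − Π₂ R_{k+1} K(B₀)`** — (6.16); by translation invariance of
  `H, K` this single coefficient vector is `H̃_k(B)` for every `k`-block `B` and, since
  `H_{k+1}(B') = Σ_{B ∈ 𝓑_k(B')} H̃_k(B)` ((6.15)) is the same density summed over `B'`, it IS the
  coefficient vector of `H_{k+1}` (`eval_eq_sum_blocks`);
* **`nextKStep D H K = K_{k+1}`** — (6.34) with `π = reblock s (L s)` ((6.25)–(6.26)),
  `I = e^{−H}`, `Ĩ = e^{−H̃}`, `μ = stepMeasure 𝒞`; `rgStep D (H, K) = (H_{k+1}, K_{k+1})` — `T_k`;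
* **`rgStep_identity`** — Proposition 6.6 / (6.13) for `T_k`:
  `∫ (e^{−H_k} ∘_k K_k)(Λ, φ + ξ) μ_{k+1}(dξ) = (e^{−H_{k+1}} ∘_{k+1} K_{k+1})(Λ, φ)` where
  `(e^{−H} ∘_j K)(Λ) = Σ_{U ∈ 𝓟_j} K(U) e^{−H(Λ∖U)}` (`TorusPolymer.pcirc`);
* `nextKStep_empty` (`K_{k+1}(∅) = 1` when `K(∅) = 1`), **`transInv_nextKStep`** (Lemma 6.4 (1)),
  **`isGaugeLocal_nextKStep`** (Lemma 6.4 (2)–(3), locality on `U* = U + [−r_{k+1}, r_{k+1}]^d`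
  from locality of `K` on `X* = X + [−r_k,r_k]^d`, radii with `r_k + (2^d−1)L^k ≤ r_{k+1}`).

* (appended) `Factorises s K` and **`factorises_nextKStep`** — Lemma 6.4 (5) for `T_k`
  (`RenormalisationStepFactorisation.nextK_union`).

Everything is proved; no named fact.  Not here: norms and estimates (Ch. 6.4–10), the
linearisation (Theorem 6.8).

## References
* S. Adams, S. Buchholz, R. Kotecký, S. Müller, arXiv:1910.13564, Definition 6.5, (6.13)–(6.18),
  (6.34), Proposition 6.6, Lemma 6.4 (1)–(3) [AdamsBuchholzKoteckyMuller2019].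
-/

noncomputable section

namespace Literature.MathematicalPhysics.StatisticalMechanics.GradientRG

open scoped BigOperators Classical
open Finset MeasureTheory
open Literature.MathematicalPhysics.StatisticalMechanics.TorusPolymer
  hiding translate translate_translate translate_zero translate_empty translate_union translate_sdiff
    translate_inj translate_biUnion translate_subset_translate_iff mem_translate add_mem_translate_iff
    card_translate

variable {d M : ℕ} [NeZero M]

/-! ## The data of one step and the map -/

/-- The data of the renormalisation step `k → k+1` on `(ℤ/M)^d`: block side `s = L^k`, ratio `L`
(next side `L·s`), the kernel `𝒞 = 𝒞_{k+1}` of the fluctuation covariance, and the reference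
`k`-block `B₀` with the corner `c₀` of the box carrying the test polynomials of `Π₂`.
[cite: AdamsBuchholzKoteckyMuller2019, Definition 6.5] -/
structure StepData (d M : ℕ) where
  /-- block side `L^k` of the current scale -/
  s : ℕ
  /-- the scale ratio `L` (next block side `L * s`) -/
  L : ℕ
  /-- kernel of the fluctuation covariance `𝒞_{k+1}` (`μ_{k+1} = N(0, circulant 𝒞)`) -/
  𝒞 : (Fin d → ZMod M) → ℝ
  /-- corner of the test-polynomial box of the reference block (centre of `Π₂`'s polynomials) -/
  c₀ : Fin d → ZMod M
  /-- the reference `k`-block `B₀` at which `H̃_k = Π₂R_{k+1}H(B₀) − Π₂R_{k+1}K(B₀)` is read off -/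
  B₀ : Finset (Fin d → ZMod M)

/-- The fluctuation integral `R_{k+1}F(φ) = ∫ F(φ + ξ) μ_{k+1}(dξ)`, `μ_{k+1} = stepMeasure 𝒞`.
[cite: AdamsBuchholzKoteckyMuller2019, Ch. 6.1 (6.9)] -/
def fluct (𝒞 : (Fin d → ZMod M) → ℝ) (F : ((Fin d → ZMod M) → ℝ) → ℂ) (φ : (Fin d → ZMod M) → ℝ) : ℂ :=
  ∫ ξ, F (φ + ξ) ∂(stepMeasure 𝒞)

/-- The one-block functional `e^{−H(B, φ)}` of a relevant Hamiltonian.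
[cite: AdamsBuchholzKoteckyMuller2019, Ch. 6.3 (6.18)] -/
def expNegH (H : RelevantHamiltonian ℂ d) (B : Finset (Fin d → ZMod M)) (φ : (Fin d → ZMod M) → ℝ) : ℂ :=
  Complex.exp (-(eval H B φ))

/-- **`H_{k+1}` ((6.15)–(6.16))**: the coefficient vector `H̃_k = Π₂ R_{k+1} H_k(B₀) − Π₂ R_{k+1} K_k(B₀)`
read off at the reference block; for translation-invariant `H_k, K_k` it is the same at every
block, and `H_{k+1}(B') = Σ_{B ∈ 𝓑_k(B')} H̃_k(B) = H̃_k(B')` as functionals.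
[cite: AdamsBuchholzKoteckyMuller2019, Definition 6.5 (6.15)–(6.16)] -/
def nextH (D : StepData d M) (H : RelevantHamiltonian ℂ d)
    (K : Finset (Fin d → ZMod M) → ((Fin d → ZMod M) → ℝ) → ℂ) : RelevantHamiltonian ℂ d :=
  Pi2 D.c₀ D.B₀ (fluct D.𝒞 (eval H D.B₀)) - Pi2 D.c₀ D.B₀ (fluct D.𝒞 (K D.B₀))

/-- **`K_{k+1}` ((6.34))** for the reblocking map `π` of (6.25)–(6.26), `I = e^{−H_k}`,
`Ĩ = e^{−H̃_k}`, `μ = μ_{k+1}`. [cite: AdamsBuchholzKoteckyMuller2019, Definition 6.5 (6.34)] -/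
def nextKStep (D : StepData d M) (H : RelevantHamiltonian ℂ d)
    (K : Finset (Fin d → ZMod M) → ((Fin d → ZMod M) → ℝ) → ℂ) :
    Finset (Fin d → ZMod M) → ((Fin d → ZMod M) → ℝ) → ℂ :=
  nextK D.s (reblock D.s (D.L * D.s)) (stepMeasure D.𝒞) (expNegH H) (expNegH (nextH D H K)) K

/-- **The renormalisation transformation `T_k(H_k, K_k) = (H_{k+1}, K_{k+1})`.**
[cite: AdamsBuchholzKoteckyMuller2019, Definition 6.5] -/
def rgStep (D : StepData d M)
    (HK : RelevantHamiltonian ℂ d × (Finset (Fin d → ZMod M) → ((Fin d → ZMod M) → ℝ) → ℂ)) :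
    RelevantHamiltonian ℂ d × (Finset (Fin d → ZMod M) → ((Fin d → ZMod M) → ℝ) → ℂ) :=
  (nextH D HK.1 HK.2, nextKStep D HK.1 HK.2)

/-! ## Proposition 6.6 for `T_k` -/

/-- **Proposition 6.6 / (6.13) for `T_k`.**  For odd `s, L` and a fluctuation integral making
`ξ ↦ e^{−H(Z, φ+ξ)} K(Y, φ+ξ)` integrable for all `k`-polymers `Z, Y`:
`∫ (e^{−H_k} ∘_k K_k)(Λ, φ+ξ) μ_{k+1}(dξ) = (e^{−H_{k+1}} ∘_{k+1} K_{k+1})(Λ, φ)`, both sides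
written with `TorusPolymer.pcirc` and the polymer functional `Z ↦ e^{−H(Z, ·)}` (`= ∏_B e^{−H(B,·)}`
over the blocks of either scale, `bprod_cexp_neg_eval`).
[cite: AdamsBuchholzKoteckyMuller2019, Proposition 6.6] -/
theorem rgStep_identity (D : StepData d M) (hs : Odd D.s) (hL : Odd D.L) (H : RelevantHamiltonian ℂ d)
    {K : Finset (Fin d → ZMod M) → ((Fin d → ZMod M) → ℝ) → ℂ} {φ : (Fin d → ZMod M) → ℝ}
    (hint : ∀ Z Y, IsPolymer D.s Z → IsPolymer D.s Y →
      Integrable (fun ξ => Complex.exp (-(eval H Z (φ + ξ))) * K Y (φ + ξ)) (stepMeasure D.𝒞)) :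
    ∫ ξ, pcirc D.s (fun Z => expNegH H Z (φ + ξ)) (fun Y => K Y (φ + ξ)) univ ∂(stepMeasure D.𝒞)
      = pcirc (D.L * D.s) (fun U => nextKStep D H K U φ) (fun V => expNegH (nextH D H K) V φ) univ := by
  unfold expNegH nextKStep
  rw [integral_pcirc_cexp_eq hs hL (fun X _ => isPolymer_reblock D.s (D.L * D.s) X)
    (stepMeasure D.𝒞) H (nextH D H K) hint]
  rfl

/-! ## `K_{k+1}(∅) = 1` -/

/-- The step measure is a probability measure. [cite: AdamsBuchholzKoteckyMuller2019, Ch. 4 (4.2)] -/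
theorem isProbabilityMeasure_stepMeasure (𝒞 : (Fin d → ZMod M) → ℝ) :
    IsProbabilityMeasure (stepMeasure 𝒞) := by
  unfold stepMeasure
  exact Measure.isProbabilityMeasure_map (PiLp.continuous_ofLp 2 _).measurable.aemeasurable

/-- **`K_{k+1}(∅) = 1` when `K_k(∅) = 1`**: only `X = ∅` has `π(X) = ∅`, and
`Φ(∅, φ, ξ) = K(∅, φ + ξ) = 1`. [cite: AdamsBuchholzKoteckyMuller2019, Definition 6.5 (6.25): π(∅) = ∅] -/
theorem nextKStep_empty (D : StepData d M) (H : RelevantHamiltonian ℂ d)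
    {K : Finset (Fin d → ZMod M) → ((Fin d → ZMod M) → ℝ) → ℂ} (hK : ∀ φ, K ∅ φ = 1)
    (φ : (Fin d → ZMod M) → ℝ) : nextKStep D H K ∅ φ = 1 := by
  haveI := isProbabilityMeasure_stepMeasure D.𝒞
  unfold nextKStep nextK
  have hfilter : (polys D.s (univ : Finset (Fin d → ZMod M))).filter
      (fun X => reblock D.s (D.L * D.s) X = ∅) = {∅} := by
    ext X
    rw [mem_filter, mem_singleton, reblock_eq_empty_iff]
    exact ⟨fun h => h.2, fun h => ⟨h ▸ empty_mem_polys D.s _, h⟩⟩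
  rw [hfilter, sum_singleton]
  simp [hK]

/-! ## Lemma 6.4 (1): translation invariance -/

/-- **Lemma 6.4 (1) for `T_k`**: if `K_k` is translation invariant on scale `k` then `K_{k+1}` is
translation invariant on scale `k+1` (`M = (L s)·t'` odd, `L ≥ 2^d`, `circulant 𝒞 ⪰ 0`).
[cite: AdamsBuchholzKoteckyMuller2019, Lemma 6.4 (1)] -/
theorem transInv_nextKStep (D : StepData d M) {t' : ℕ} (hMst : M = (D.L * D.s) * t') (hs : Odd D.s)
    (hL : Odd D.L) (ht' : Odd t') (hL2 : 2 ^ d * D.s ≤ D.L * D.s)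
    (hC : (Matrix.circulant D.𝒞).PosSemidef) (H : RelevantHamiltonian ℂ d)
    {K : Finset (Fin d → ZMod M) → ((Fin d → ZMod M) → ℝ) → ℂ} (hK : TransInv D.s K) :
    TransInv (D.L * D.s) (nextKStep D H K) := by
  intro c hc U φ
  unfold nextKStep
  exact nextK_translate hMst hs (hL.mul hs) ht' (Dvd.intro_left _ rfl)
    (fun c hc X _ => reblock_translate hMst hs (hL.mul hs) ht' (Dvd.intro_left _ rfl) hL2 X hc)
    (transInv_cexp_neg_eval D.s H) (transInv_cexp_neg_eval D.s (nextH D H K)) hK hc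
    (map_fieldShift_stepMeasure hC c) U φ

/-! ## Lemma 6.4 (2)–(3): locality -/

/-- **Lemma 6.4 (2)–(3) for `T_k`**: if `K_k(Y, ·)` is gauge-local on `Y + [−r,r]^d` for every
`k`-polymer `Y`, then `K_{k+1}(U, ·)` is gauge-local on `U + [−r',r']^d` — for radii with
`r ≤ r'`, `r + (2^d − 1)s ≤ r'` (the radii `r_k` of `X*`, (6.25), when `L ≥ 2^d + R`), gauge order
`p ≥ ⌊d/2⌋+1`, odd torus `M = s·t`. [cite: AdamsBuchholzKoteckyMuller2019, Lemma 6.4 (2)–(3)] -/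
theorem isGaugeLocal_nextKStep (D : StepData d M) {t : ℕ} (hMst : M = D.s * t) (hs : Odd D.s)
    (ht : Odd t) (hL : Odd D.L) {𝔥 R : ℝ} (h𝔥 : 𝔥 ≠ 0) (hR : R ≠ 0) {p : ℕ} (hp : d / 2 + 1 ≤ p)
    {r r' : ℕ} (hrr : r ≤ r') (hr : r + (2 ^ d - 1) * D.s ≤ r') (H : RelevantHamiltonian ℂ d)
    {K : Finset (Fin d → ZMod M) → ((Fin d → ZMod M) → ℝ) → ℂ}
    (hK : ∀ Y, IsPolymer D.s Y → IsGaugeLocal (fieldGauge 𝔥 R p (thicken r Y)) (K Y))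
    (U : Finset (Fin d → ZMod M)) :
    IsGaugeLocal (fieldGauge 𝔥 R p (thicken r' U)) (nextKStep D H K U) := by
  unfold nextKStep
  exact isGaugeLocal_nextK h𝔥 hR hs hL (fun X _ => isPolymer_reblock D.s (D.L * D.s) X)
    (fun X _ => thicken_subset_thicken_reblock hMst hs ht hL hrr hr X) (stepMeasure D.𝒞)
    (fun B S hBS => isGaugeLocal_cexp_neg_eval h𝔥 hR hp hBS H)
    (fun B S hBS => isGaugeLocal_cexp_neg_eval h𝔥 hR hp hBS (nextH D H K)) hK U

/-! ## Lemma 6.4 (5): factorisation (appended) -/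

/-- **`K` factors on scale `k`** (`s = L^k`): `K(X₁ ∪ X₂, φ) = K(X₁, φ) K(X₂, φ)` for strictly disjoint
`k`-polymers, i.e. `(L^k + 1)`-separated ones ([ABKM19] (6.35); `dist(X₁,X₂) > L^k` for strictly
disjoint `k`-polymers, `TorusPolymer.separated_of_forall_not_adj`).
[cite: AdamsBuchholzKoteckyMuller2019, Lemma 6.4 (5) (6.35)] -/
def Factorises (s : ℕ) (K : Finset (Fin d → ZMod M) → ((Fin d → ZMod M) → ℝ) → ℂ) : Prop :=
  ∀ X₁ X₂ : Finset (Fin d → ZMod M), IsPolymer s X₁ → IsPolymer s X₂ → Separated (s + 1) X₁ X₂ →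
    ∀ φ : (Fin d → ZMod M) → ℝ, K (X₁ ∪ X₂) φ = K X₁ φ * K X₂ φ

/-- `e^{−H(B,·)}` is measurable in the field (it is smooth).
[cite: AdamsBuchholzKoteckyMuller2019, Ch. 6.3 (6.18)] -/
theorem measurable_expNegH (H : RelevantHamiltonian ℂ d) (B : Finset (Fin d → ZMod M)) :
    Measurable (expNegH H B) := by
  unfold expNegH
  exact (Complex.continuous_exp.comp ((contDiff_eval H B (n := 0)).continuous.neg)).measurable

/-- **Lemma 6.4 (5) for `T_k`**: if `K_k` factors on scale `k`, is gauge-local on `Y + [−r,r]^d` and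
measurable, then `K_{k+1}` factors on scale `k+1`, provided the fluctuation kernel `𝒞` is even,
zero-sum, positive on mean-zero fields and constant beyond the range `ρ` (clauses (o), (i), (iii)
of `GradientFRD.TorusFRD`), and `L` is large in the sense `2r' + 2p + ρ ≤ L·s + 1`,
`2r' + s + 1 ≤ L·s + 1`, `2r' + 2 ≤ L·s + 1` for radii `r ≤ r'`, `r + (2^d−1)s ≤ r'` ((6.21)).
[cite: AdamsBuchholzKoteckyMuller2019, Lemma 6.4 (5)] -/
theorem factorises_nextKStep (D : StepData d M) {t p r r' ρ : ℕ} {𝔥 R : ℝ} (h𝔥 : 𝔥 ≠ 0) (hR : R ≠ 0)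
    (hMst : M = D.s * t) (hs : Odd D.s) (ht : Odd t) (hL : Odd D.L)
    (hrr : r ≤ r') (hr : r + (2 ^ d - 1) * D.s ≤ r')
    (hD : 2 * r' + 2 ≤ D.L * D.s + 1) (hDs : 2 * r' + (D.s + 1) ≤ D.L * D.s + 1)
    (hDρ : 2 * r' + 2 * p + ρ ≤ D.L * D.s + 1) (hp : d / 2 + 1 ≤ p)
    (h0 : ∑ x, D.𝒞 x = 0) (heven : ∀ x, D.𝒞 (-x) = D.𝒞 x)
    (hpos : ∀ φ : (Fin d → ZMod M) → ℝ, ∑ x, φ x = 0 → 0 ≤ ∑ x, ∑ y, φ x * D.𝒞 (x - y) * φ y)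
    {m : ℝ} (hm : m ≤ 0) (hrange : ∀ x, ρ ≤ GradientFRD.supNorm x → D.𝒞 x = m)
    (H : RelevantHamiltonian ℂ d) {K : Finset (Fin d → ZMod M) → ((Fin d → ZMod M) → ℝ) → ℂ}
    (hKloc : ∀ Y, IsPolymer D.s Y → IsGaugeLocal (fieldGauge 𝔥 R p (thicken r Y)) (K Y))
    (hKmeas : ∀ Y, Measurable (K Y)) (hKfac : Factorises D.s K) :
    Factorises (D.L * D.s) (nextKStep D H K) := by
  intro U₁ U₂ hU₁ hU₂ hsep φ
  unfold nextKStep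
  exact nextK_union h𝔥 hR hMst hs ht hL hrr hr hD hDs hDρ h0 heven hpos hm hrange
    (fun B S hBS => isGaugeLocal_cexp_neg_eval h𝔥 hR hp hBS H) (measurable_expNegH H) hKloc hKmeas
    hKfac hU₁ hU₂ hsep φ

end Literature.MathematicalPhysics.StatisticalMechanics.GradientRG

end
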